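import Summits.QuantumFields.BalabanUV.T4Continuum.Support.SpreadLiftWords

/-!
# SpreadLiftDirection (T⁴ programme, node NE3, crew row S6-Y7 (c) `replicationRightInverse`, file 2/5) — THE COVARIANT SPREAD
# LIFT OF COARSE DATA, THE LIFT MAP OF A COARSE BOND, ITS LOCALITY, AND THE STAIR LOOP OF THE NEXT BLOCK

HONEST FRAMING (cell `pub-balaban`, T4-DAG PAGE 1; unit `b2b-balaban-t4-ne3-formalise-leaf-01` gen 3, NE3 (node U1b)
formalisation swarm, crew sub-row **S6-Y7 (c)** of `t4/formal/NE3/LEAVES.md` = leaf **L7(c) `replicationRightInverse`** of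
the road-P3 skeleton `t4/skeletons/NE3-t4-ne3-p3.md` §2).  The cell's T4 target is the finite-torus continuum limit of the
unit-scale averaged loop expectations — NOT infinite volume, NO mass gap, NOT Clay, NOT summit progress.  All [folklore],
0 sorry: §1 THE SPREAD LIFT `spreadLift L V φ`: on every crossing bond `⟨z, z+e_i⟩` the datum `φ(⌊z/L⌋, i)` transported from
the corner `L(⌊z/L⌋ + e_i)` of the next block along the tree contour, `Ad_{V(Γ_{L(⌊z/L⌋+e_i), z+e_i})⁻¹} φ(⌊z/L⌋, i)`, zero
elsewhere (support, linearity in `φ`, `𝔲(N)` values, pointwise norms, locality in the data, and its values on the words of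
`c`: `spreadLift_crossSite`, `spreadLift_faceSite`); §2 THE LIFT MAP of the coarse bond `c = (y, κ)`,
`spreadMap L V y κ : m ↦ pushDir L V (spreadLift L V (bondDir y κ m)) (c)` (ℝ-linear by `pushDir_add/smul`), and LOCALITY
`pushDir L V (spreadLift L V φ) (c) = spreadMap … (φ c)` (file 1's classification: on the words of `c` the only crossing bonds
are crossing `κ`-bonds of the column of `c`); §3 THE STAIR LOOP `Γ_{q′, q′+r⊥} ∪ [q′+r⊥, q′+r] ∪ −Γ_{q′, q′+r}` at
`q′ = L(y + e_κ)` — exactly the discrepancy between the transported value on the crossing bond of `Γ_{c,x}` and the value that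
`−Γ_c` gives back — and its bound `‖V(stair) − 1‖ ≤ d·L²·a` in the axial gauge of B7 p. 24 (`axial_bond_bound`,
`hol_axial_treeWord` BY NAME).  File 3 `SpreadLiftMap`: the map is `id + O(dL²a)`, invertible; file 4 `SpreadLift`: the
one-level right inverse; file 5: the tower.  NOT NE3 in disguise: kinematics of one averaging operator at one background.
NE3 is NOT proved by this file.
CITATION HEADER: no printed sentence is a hypothesis; the manuscripts under audit are not cited for any disputed step;
context: T. Bałaban, Commun. Math. Phys. **98** (1985) 17–51 [Balaban1985Averaging] ((9) p. 18, (14) p. 19, (42) p. 23,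
p. 24–25); **95** (1984) 17–40 [Balaban1984PropagatorsI] ((1.6)–(1.8) p. 18).
PLACEMENT: `Summits/QuantumFields/BalabanUV/` (human rule 2026-08-19).  Record: HOME `t4/formal/NE3/LEAVES.md` row S5∕S6.
-/

set_option autoImplicit false

open scoped BigOperators Matrix Matrix.Norms.L2Operator Topology
open NormedSpace Finset Filter

namespace Summit.QuantumFields.BalabanUV.T4Continuum.SpreadLiftDirection

open Literature.MathematicalPhysics.QuantumFieldTheory.Balaban1983to89
open B7Prop1Explicit B7Prop2Explicit MatrixLog UnitaryModel
open T4AveragingDeficitWall hiding Site Plane Plaq Bond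
open T4AveragingDeficitNonAbelian (Ad_mul Ad_sub)
open AveragingDeficitTransport AveragingDeficitLocality AveragingDeficitNearIdentity AveragingDeficitSideDeriv
open AveragingDeficitResidualPairing AveragingDeficitTransportCalc AveragingDeficitPushForwardLinear
open AveragingDeficitFaceWords (faceSite boxVec_bounds)
open AveragingDeficitLiftMap (bondDir bondDir_self bondDir_add bondDir_smul LoopBound)
open SkeletonLattice (cdiv cmod smul_cdiv_add_cmod cmod_nonneg cmod_lt cdiv_eq_of_repr cmod_eq_of_repr)
open SpreadLiftWords

noncomputable section

variable {d : ℕ} {n : Type*} [Fintype n] [DecidableEq n]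

/-! ## §1 The spread lift of coarse data -/

/-- The corner `L(⌊z/L⌋ + e_i)` of the block ENTERED by the crossing bond `⟨z, z + e_i⟩`. [folklore] -/
def exitCorner (L : ℕ) (z : Site d) (i : Fin d) : Site d := (L : ℤ) • (cdiv L z + e i)

/-- The transport `V(Γ_{L(⌊z/L⌋+e_i), z+e_i})` from that corner to the end point of the bond along the tree contour.
[cite: Balaban1985Averaging, p.24] -/
def crossHol (L : ℕ) (V : Site d → Fin d → (Matrix n n ℂ)ˣ) (z : Site d) (i : Fin d) : (Matrix n n ℂ)ˣ :=
  hol V (exitCorner L z i) (treeWord (z + e i - exitCorner L z i))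

/-- **THE SPREAD LIFT** of coarse data `φ`: on every crossing bond `⟨z, z + e_i⟩` of the coarse bond `(⌊z/L⌋, i)` the value
`φ(⌊z/L⌋, i)` parallel-transported from the corner of the next block, `Ad_{V(Γ_{L(⌊z/L⌋+e_i), z+e_i})⁻¹} φ(⌊z/L⌋, i)`; zero
on all other bonds. [folklore] -/
def spreadLift (L : ℕ) (V : Site d → Fin d → (Matrix n n ℂ)ˣ) (φ : Site d → Fin d → (Matrix n n ℂ)) : Site d → Fin d → (Matrix n n ℂ) :=
  fun z i => if IsCross L z i then Ad (crossHol L V z i)⁻¹ (φ (cdiv L z) i) else 0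

/-- Value on a crossing bond. [folklore] -/
theorem spreadLift_of_isCross (L : ℕ) (V : Site d → Fin d → (Matrix n n ℂ)ˣ) (φ : Site d → Fin d → (Matrix n n ℂ)) {z : Site d} {i : Fin d}
    (h : IsCross L z i) : spreadLift L V φ z i = Ad (crossHol L V z i)⁻¹ (φ (cdiv L z) i) := by
  unfold spreadLift; rw [if_pos h]

/-- Zero off the crossing bonds. [folklore] -/
theorem crossSupported_spreadLift (L : ℕ) (V : Site d → Fin d → (Matrix n n ℂ)ˣ) (φ : Site d → Fin d → (Matrix n n ℂ)) :
    CrossSupported L (spreadLift L V φ) := fun z i h => by unfold spreadLift; rw [if_neg h]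

/-- The spread lift is additive in the data. [folklore] -/
theorem spreadLift_add (L : ℕ) (V : Site d → Fin d → (Matrix n n ℂ)ˣ) (φ φ' : Site d → Fin d → (Matrix n n ℂ)) :
    spreadLift L V (φ + φ') = spreadLift L V φ + spreadLift L V φ' := by
  funext z i
  simp only [spreadLift, Pi.add_apply]
  split_ifs
  · exact Ad_add _ _ _
  · simp

/-- The spread lift is real-homogeneous in the data. [folklore] -/
theorem spreadLift_smul (L : ℕ) (V : Site d → Fin d → (Matrix n n ℂ)ˣ) (c : ℝ) (φ : Site d → Fin d → (Matrix n n ℂ)) :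
    spreadLift L V (c • φ) = c • spreadLift L V φ := by
  funext z i
  simp only [spreadLift, Pi.smul_apply]
  split_ifs
  · exact Ad_real_smul _ _ _
  · simp

/-- The spread lift of zero data is zero. [folklore] -/
theorem spreadLift_zero (L : ℕ) (V : Site d → Fin d → (Matrix n n ℂ)ˣ) :
    spreadLift L V (0 : Site d → Fin d → (Matrix n n ℂ)) = 0 := by
  funext z i
  simp only [spreadLift, Pi.zero_apply, Ad_zero, ite_self]

/-- The transports are unitary on `U(N)` data. [folklore] -/
theorem crossHol_mem (L : ℕ) {V : Site d → Fin d → (Matrix n n ℂ)ˣ} (hV : IsUnitaryCfg V) (z : Site d) (i : Fin d) :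
    crossHol L V z i ∈ unitaryUnits (Matrix n n ℂ) := hol_mem_of hV _ _

/-- The spread lift of `𝔲(N)` data on `U(N)` configurations is a `𝔲(N)` direction. [folklore] -/
theorem isSkewDir_spreadLift (L : ℕ) {V : Site d → Fin d → (Matrix n n ℂ)ˣ} (hV : IsUnitaryCfg V) {φ : Site d → Fin d → (Matrix n n ℂ)}
    (hφ : ∀ y κ, φ y κ ∈ skewAdjoint (Matrix n n ℂ)) : IsSkewDir (spreadLift L V φ) := by
  intro z i
  unfold spreadLift
  split_ifs
  · exact Ad_mem_skewAdjoint ((unitaryUnits (Matrix n n ℂ)).inv_mem (crossHol_mem L hV z i)) (hφ _ _)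
  · exact (skewAdjoint (Matrix n n ℂ)).zero_mem

/-- **POINTWISE NORMS**: `‖spreadLift φ (z, i)‖ = ‖φ(⌊z/L⌋, i)‖` on crossing bonds (unitary transport), `0` elsewhere; hence
`≤ ‖φ(⌊z/L⌋, i)‖` everywhere. [folklore] -/
theorem norm_spreadLift_le (L : ℕ) {V : Site d → Fin d → (Matrix n n ℂ)ˣ} (hV : IsUnitaryCfg V) (φ : Site d → Fin d → (Matrix n n ℂ))
    (z : Site d) (i : Fin d) : ‖spreadLift L V φ z i‖ ≤ ‖φ (cdiv L z) i‖ := by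
  unfold spreadLift
  split_ifs
  · exact (norm_Ad_of_unitary ((unitaryUnits (Matrix n n ℂ)).inv_mem (crossHol_mem L hV z i)) _).le
  · rw [norm_zero]; exact norm_nonneg _

/-- On a crossing bond the norm is exactly that of the datum. [folklore] -/
theorem norm_spreadLift_of_isCross (L : ℕ) {V : Site d → Fin d → (Matrix n n ℂ)ˣ} (hV : IsUnitaryCfg V) (φ : Site d → Fin d → (Matrix n n ℂ))
    {z : Site d} {i : Fin d} (h : IsCross L z i) : ‖spreadLift L V φ z i‖ = ‖φ (cdiv L z) i‖ := by
  rw [spreadLift_of_isCross L V φ h]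
  exact norm_Ad_of_unitary ((unitaryUnits (Matrix n n ℂ)).inv_mem (crossHol_mem L hV z i)) _

/-- LOCALITY IN THE DATA: `spreadLift φ (z, i)` depends on `φ` only through `φ(⌊z/L⌋, i)`. [folklore] -/
theorem spreadLift_congr (L : ℕ) (V : Site d → Fin d → (Matrix n n ℂ)ˣ) {φ φ' : Site d → Fin d → (Matrix n n ℂ)} {z : Site d} {i : Fin d}
    (h : φ (cdiv L z) i = φ' (cdiv L z) i) : spreadLift L V φ z i = spreadLift L V φ' z i := by
  unfold spreadLift; rw [h]

/-- The transport at the crossing bond of the straight contour from `Ly + r`: `V(Γ_{L(y+e_κ), L(y+e_κ) + perpOff r})`.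
[folklore] -/
theorem crossHol_crossSite {L : ℕ} (hL : 1 ≤ L) (V : Site d → Fin d → (Matrix n n ℂ)ˣ) (y : Site d) (κ : Fin d) (r : Fin d → Fin L) :
    crossHol L V ((L : ℤ) • y + boxVec L (crossOff hL κ r)) κ
      = hol V ((L : ℤ) • (y + e κ)) (treeWord (boxVec L (perpOff hL κ r))) := by
  unfold crossHol exitCorner
  rw [cdiv_smul_add_boxVec]
  congr 2
  rw [add_assoc, boxVec_crossOff_add_e, smul_add]
  abel

/-- **VALUE AT THE CROSSING BOND OF THE CONTOUR FROM `Ly + r`**: the datum of `(y, κ)` transported from `L(y + e_κ)`.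
[folklore] -/
theorem spreadLift_crossSite {L : ℕ} (hL : 1 ≤ L) (V : Site d → Fin d → (Matrix n n ℂ)ˣ) (φ : Site d → Fin d → (Matrix n n ℂ)) (y : Site d)
    (κ : Fin d) (r : Fin d → Fin L) :
    spreadLift L V φ ((L : ℤ) • y + boxVec L (crossOff hL κ r)) κ
      = Ad (hol V ((L : ℤ) • (y + e κ)) (treeWord (boxVec L (perpOff hL κ r))))⁻¹ (φ y κ) := by
  rw [spreadLift_of_isCross L V φ (isCross_crossOff hL y κ r), crossHol_crossSite hL, cdiv_smul_add_boxVec]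

/-- **VALUE AT THE FACE BOND `b₀(c)`**: the bare datum `φ(y, κ)` (the transport is along the empty tree word). [folklore] -/
theorem spreadLift_faceSite {L : ℕ} (hL : 1 ≤ L) (V : Site d → Fin d → (Matrix n n ℂ)ˣ) (φ : Site d → Fin d → (Matrix n n ℂ)) (y : Site d)
    (κ : Fin d) : spreadLift L V φ (faceSite L y κ) κ = φ y κ := by
  rw [faceSite_eq hL, spreadLift_crossSite hL]
  have h0 : boxVec L (perpOff hL κ (fun _ : Fin d => (⟨0, by omega⟩ : Fin L))) = 0 := by
    funext j; simp only [boxVec, perpOff, Pi.zero_apply]; split_ifs <;> simp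
  rw [h0, treeWord_zero, hol_nil, inv_one, Ad_one]

/-! ## §2 The spread lift map of a coarse bond; locality -/

/-- **THE SPREAD LIFT MAP of the coarse bond `c = (y, κ)`**: `m ↦ pushDir L V (spreadLift L V (bondDir y κ m)) (c)`, an
`ℝ`-linear endomorphism of `𝔤𝔩(N, ℂ)`. [cite: Balaban1985Averaging, (42) p.23] -/
def spreadMap (L : ℕ) (V : Site d → Fin d → (Matrix n n ℂ)ˣ) (y : Site d) (κ : Fin d) {w : ℝ} (hw : w ≤ 1 / 32)
    (hW : LoopBound L V y κ w) : (Matrix n n ℂ) →ₗ[ℝ] (Matrix n n ℂ) where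
  toFun m := pushDir L V (spreadLift L V (bondDir y κ m)) ((L : ℤ) • y) κ
  map_add' m m' := by
    simp only [bondDir_add, spreadLift_add]
    exact pushDir_add L V _ _ _ κ fun r => (hW r).trans hw
  map_smul' c m := by
    simp only [bondDir_smul, spreadLift_smul, RingHom.id_apply]
    exact pushDir_smul L V c _ _ κ fun r => (hW r).trans hw

/-- `spreadMap` unfolds. [folklore] -/
theorem spreadMap_apply (L : ℕ) (V : Site d → Fin d → (Matrix n n ℂ)ˣ) (y : Site d) (κ : Fin d) {w : ℝ} (hw : w ≤ 1 / 32)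
    (hW : LoopBound L V y κ w) (m : (Matrix n n ℂ)) :
    spreadMap L V y κ hw hW m = pushDir L V (spreadLift L V (bondDir y κ m)) ((L : ℤ) • y) κ := rfl

omit [Fintype n] [DecidableEq n] in
/-- A crossing bond on the words of `c = (y, κ)` is a crossing `κ`-bond of the column of `c`: its coarse bond is `(y, κ)`.
[folklore] -/
theorem cdiv_eq_of_mem_words {L : ℕ} (hL : 1 ≤ L) (y : Site d) (κ : Fin d) (b : Site d × Fin d)
    (hb : (∃ r : Fin d → Fin L, b ∈ bondsOf ((L : ℤ) • y) (loopWord L κ (boxVec L r)))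
      ∨ b ∈ bondsOf ((L : ℤ) • y) (seg κ (L : ℤ))) (hc : IsCross L b.1 b.2) :
    cdiv L b.1 = y ∧ b.2 = κ := by
  have hr0 : boxVec L (fun _ : Fin d => (⟨0, hL⟩ : Fin L)) = 0 := by funext i; simp [boxVec]
  rcases hb with ⟨r, hb⟩ | hb
  · rw [loopWord, bondsOf_append, disp_gammaWord, List.mem_append, gammaWord, bondsOf_append, List.mem_append,
      bondsOf_append, List.mem_append, disp_treeWord, disp_append, disp_treeWord, disp_seg] at hb
    rcases hb with ((hb | hb) | hb) | hb
    · exact absurd hc (not_isCross_of_mem_treeWord hL y r hb)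
    · have e := eq_of_mem_seg_isCross hL y κ r hb hc
      rw [e]; exact ⟨cdiv_smul_add_boxVec L y _, rfl⟩
    · rw [show (L : ℤ) • y + (boxVec L r + (L : ℤ) • e κ) = ((L : ℤ) • (y + e κ)) + disp (treeWord (boxVec L r)) by
        rw [disp_treeWord, smul_add]; abel] at hb
      exact absurd hc (not_isCross_of_mem_treeWord hL (y + e κ) r (AveragingDeficitFaceLift.mem_bondsOf_revWord _ _ b hb))
    · obtain ⟨j, hj, rfl⟩ := (mem_bondsOf_seg_neg_iff _ κ L b).mp hb
      have := (isCross_back_iff hL y κ hj).mp hc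
      subst this
      refine ⟨?_, rfl⟩
      have e : (L : ℤ) • y + (L : ℤ) • e κ - (((0 : ℕ) : ℤ) + 1) • e κ = faceSite L y κ := by
        simp only [faceSite]; push_cast; module
      rw [e]; exact cdiv_faceSite hL y κ
  · have hb' : b ∈ bondsOf ((L : ℤ) • y + boxVec L (fun _ : Fin d => (⟨0, hL⟩ : Fin L))) (seg κ (L : ℤ)) := by
      rw [hr0, add_zero]; exact hb
    have e := eq_of_mem_seg_isCross hL y κ _ hb' hc
    rw [e]; exact ⟨cdiv_smul_add_boxVec L y _, rfl⟩

/-- **LOCALITY**: the push-forward of the spread lift of ANY coarse data at `c` is the lift map of `c` applied to `φ(c)` (on the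
words of `c` the spread lift sees only `φ(c)`). [cite: Balaban1985Averaging, (42) p.23] -/
theorem pushDir_spreadLift {L : ℕ} (hL : 1 ≤ L) (V : Site d → Fin d → (Matrix n n ℂ)ˣ) (y : Site d) (κ : Fin d) {w : ℝ}
    (hw : w ≤ 1 / 32) (hW : LoopBound L V y κ w) (φ : Site d → Fin d → (Matrix n n ℂ)) :
    pushDir L V (spreadLift L V φ) ((L : ℤ) • y) κ = spreadMap L V y κ hw hW (φ y κ) := by
  rw [spreadMap_apply]
  have key : ∀ b : Site d × Fin d, ((∃ r : Fin d → Fin L, b ∈ bondsOf ((L : ℤ) • y) (loopWord L κ (boxVec L r)))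
      ∨ b ∈ bondsOf ((L : ℤ) • y) (seg κ (L : ℤ))) →
      spreadLift L V φ b.1 b.2 = spreadLift L V (bondDir y κ (φ y κ)) b.1 b.2 := by
    intro b hb
    by_cases hc : IsCross L b.1 b.2
    · obtain ⟨h1, h2⟩ := cdiv_eq_of_mem_words hL y κ b hb hc
      refine spreadLift_congr L V ?_
      rw [h1, h2, bondDir_self]
    · rw [crossSupported_spreadLift L V _ _ _ hc, crossSupported_spreadLift L V _ _ _ hc]
  exact pushDir_congr L V _ κ (fun r b hb => key b (Or.inl ⟨r, hb⟩)) fun b hb => key b (Or.inr hb)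

/-! ## §3 The stair loop at the corner of the next block and its bound in the axial gauge -/

/-- The STAIR LOOP of the block point `r` seen from the corner `q′`: `Γ_{q′, q′+r⊥} ∪ [q′+r⊥, q′+r] ∪ −Γ_{q′, q′+r}`. [folklore] -/
def stairLoop {L : ℕ} (hL : 1 ≤ L) (κ : Fin d) (r : Fin d → Fin L) : List (Letter d) :=
  treeWord (boxVec L (perpOff hL κ r)) ++ (seg κ ((r κ : ℕ) : ℤ) ++ revWord (treeWord (boxVec L r)))

omit [Fintype n] [DecidableEq n] in
/-- The stair loop is closed. [folklore] -/
theorem disp_stairLoop {L : ℕ} (hL : 1 ≤ L) (κ : Fin d) (r : Fin d → Fin L) : disp (stairLoop hL κ r) = 0 := by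
  rw [stairLoop, disp_append, disp_append, disp_treeWord, disp_seg, disp_revWord, disp_treeWord, ← add_assoc,
    boxVec_perpOff_add, add_neg_cancel]

omit [Fintype n] [DecidableEq n] in
/-- The `ℓ¹` size of a point of the column above `q′ + r⊥` at height `j < L`: `≤ d·L`. [folklore] -/
theorem l1_perpOff_add_le {L : ℕ} (hL : 1 ≤ L) (κ : Fin d) (r : Fin d → Fin L) {j : ℕ} (hj : j < L) :
    (l1 (boxVec L (perpOff hL κ r) + (j : ℤ) • e κ) : ℝ) ≤ d * L := by
  let r' : Fin d → Fin L := fun i => if i = κ then ⟨j, hj⟩ else r i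
  have e : boxVec L (perpOff hL κ r) + (j : ℤ) • e κ = boxVec L r' := by
    funext i
    simp only [boxVec, perpOff, r', Pi.add_apply, Pi.smul_apply, e_apply, smul_eq_mul]
    split_ifs <;> simp
  rw [e]
  exact_mod_cast l1_boxVec_le L r'

/-- The gauge transform of `U(N)` data by unitary site variables is `U(N)`-valued. [folklore] -/
theorem isUnitaryCfg_gaugeAct' {u : Site d → (Matrix n n ℂ)ˣ} (hu : ∀ x, u x ∈ unitaryUnits (Matrix n n ℂ)) {V : Site d → Fin d → (Matrix n n ℂ)ˣ}
    (hV : IsUnitaryCfg V) : IsUnitaryCfg (gaugeAct u V) := fun x μ =>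
  (unitaryUnits (Matrix n n ℂ)).mul_mem ((unitaryUnits (Matrix n n ℂ)).mul_mem (hu x) (hV x μ)) ((unitaryUnits (Matrix n n ℂ)).inv_mem (hu _))

/-- **THE STAIR LOOP IS NEAR THE IDENTITY**: `‖V(stair) − 1‖ ≤ d·L²·a` for `U(N)` data with `|V(∂p) − 1| ≤ a` (axial gauge at
`q′`: the two tree words become `1`, the `r_κ < L` bonds of the middle segment are within `dL·a` of `1` each).
[cite: Balaban1985Averaging, p.24–25] -/
theorem norm_hol_stairLoop_sub_one_le [Nonempty n] {L : ℕ} (hL : 1 ≤ L) {V : Site d → Fin d → (Matrix n n ℂ)ˣ} (hV : IsUnitaryCfg V)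
    {a : ℝ} (ha : 0 ≤ a) (hVa : SmallField V a) (q' : Site d) (κ : Fin d) (r : Fin d → Fin L) :
    ‖((hol V q' (stairLoop hL κ r) : (Matrix n n ℂ)ˣ) : (Matrix n n ℂ)) - 1‖ ≤ d * (L : ℝ) ^ 2 * a := by
  have hU : ∀ x μ, V x μ ∈ U1 (Matrix n n ℂ) := fun x μ => mem_U1_of_unitary (hV x μ)
  set u : Site d → (Matrix n n ℂ)ˣ := axialFn V q' with hu
  set V₀ : Site d → Fin d → (Matrix n n ℂ)ˣ := gaugeAct u V with hV₀
  have huU : ∀ x, u x ∈ unitaryUnits (Matrix n n ℂ) := fun x => hol_mem_of hV _ _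
  have hV₀u : IsUnitaryCfg V₀ := isUnitaryCfg_gaugeAct' huU hV
  -- (1) gauge invariance of the closed loop: `u(q′) = V(Γ_{q′,q′}) = 1`
  have h1 : hol V q' (stairLoop hL κ r) = hol V₀ q' (stairLoop hL κ r) := by
    rw [hV₀, hol_gaugeAct_closed _ _ _ _ (disp_stairLoop hL κ r)]
    have : u q' = 1 := by rw [hu, axialFn, sub_self, treeWord_zero, hol_nil]
    rw [this, inv_one, one_mul, mul_one]
  -- (2) in the axial gauge the tree words are trivial
  set f : Site d := q' + boxVec L (perpOff hL κ r) with hf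
  have h2 : hol V₀ q' (stairLoop hL κ r) = hol V₀ f (seg κ ((r κ : ℕ) : ℤ)) := by
    rw [hV₀, hu, stairLoop, hol_append, hol_axial_treeWord, one_mul, disp_treeWord, ← hf, hol_append, disp_seg,
      hol_revWord' _ (x := q') (f + ((r κ : ℕ) : ℤ) • e κ) (treeWord (boxVec L r))
        (by rw [disp_treeWord, hf, add_assoc, boxVec_perpOff_add]),
      hol_axial_treeWord, inv_one, mul_one]
  -- (3) the bonds of the middle segment in the axial gauge
  have h3 : ∀ b ∈ bondsOf f (seg κ ((r κ : ℕ) : ℤ)), ‖((V₀ b.1 b.2 : (Matrix n n ℂ)ˣ) : (Matrix n n ℂ)) - 1‖ ≤ d * L * a := by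
    intro b hb
    obtain ⟨j, hj, rfl⟩ := (mem_bondsOf_seg_iff f κ (r κ : ℕ) b).mp hb
    have hjL : j < L := lt_trans hj (r κ).isLt
    have h := axial_bond_bound V hU q' hVa ha (f + (j : ℤ) • e κ) κ
    rw [show f + (j : ℤ) • e κ - q' = boxVec L (perpOff hL κ r) + (j : ℤ) • e κ by rw [hf]; abel] at h
    exact h.trans (mul_le_mul_of_nonneg_right (l1_perpOff_add_le hL κ r hjL) ha)
  have h4 := norm_hol_sub_one_le_of_bonds hV₀u f _ h3
  rw [length_seg, Int.natAbs_natCast] at h4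
  rw [h1, h2]
  refine h4.trans ?_
  have hr : ((r κ : ℕ) : ℝ) ≤ L := by exact_mod_cast (r κ).isLt.le
  have h0 : 0 ≤ (d : ℝ) * L * a := by positivity
  nlinarith

end

end Summit.QuantumFields.BalabanUV.T4Continuum.SpreadLiftDirection
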